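import Literature.AnabelianGeometry.SemiGraphs.CoveringComponentSupport
import Literature.AnabelianGeometry.SemiGraphs.OrbitGraphMap
import Literature.AnabelianGeometry.SemiGraphs.MorphismsOver

/-!
# Morphisms of coverings of a connected graph of anabelioids are determined on one fibre — proofs

Proof-only file ([SemiAnbd] Prop. 3.6 (ii), p. 38: faithfulness of the fibre functor
`T ↦ T_{v₀}` on `B^temp(𝒢)`).  Two morphisms `φ, ψ : T ⟶ T'` of `B^cov(𝒢)` which agree on the
fibre over one vertex `v₀` agree everywhere, provided the underlying semi-graph of `𝒢` is connected:
agreement at a point propagates along the adjacency relation in both directions (equivariance;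
compatibility with the gluings, which are bijections), every component of `T` meets the fibre
over `v₀` (`CoveringComponentSupport.lean`), and every edge abuts to a vertex
(`SemiGraph.exists_abuts_of_isConnected`).
-/

namespace Literature.AnabelianGeometry.SemiGraphs

namespace ProfiniteSemiGraph

open CategoryTheory

universe u

variable {𝒢 : ProfiniteSemiGraph.{u}} {T T' : CovObj 𝒢} (φ ψ : T ⟶ T')

/-- Agreement of `φ` and `ψ` at a point. [cite: MochizukiSemiAnbd2006, Prop 3.6(ii) p.38] -/
private def AgreePt : T.Point → Prop
  | Sum.inl ⟨v, x⟩ => (φ.fV v).hom.hom x = (ψ.fV v).hom.hom x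
  | Sum.inr ⟨e, y⟩ => (φ.fE e).hom.hom y = (ψ.fE e).hom.hom y

/-- Agreement propagates along adjacency, in both directions. [folklore] -/
private theorem agreePt_iff_of_adj {p q : T.Point} (h : T.Adj p q) : AgreePt φ ψ p ↔ AgreePt φ ψ q := by
  cases h with
  | vertex v g x =>
    change (φ.fV v).hom.hom x = (ψ.fV v).hom.hom x ↔
      (φ.fV v).hom.hom ((T.SV v).obj.ρ g x) = (ψ.fV v).hom.hom ((T.SV v).obj.ρ g x)
    rw [CovHom.fV_ρ, CovHom.fV_ρ]
    constructor
    · intro h; rw [h]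
    · intro h
      have h' := congrArg (fun z => (T'.SV v).obj.ρ g⁻¹ z) h
      change ((T'.SV v).obj.ρ g ≫ (T'.SV v).obj.ρ g⁻¹) _ =
        ((T'.SV v).obj.ρ g ≫ (T'.SV v).obj.ρ g⁻¹) _ at h'
      rw [← End.mul_def, ← map_mul, inv_mul_cancel, map_one] at h'
      exact h'
  | edge e g x =>
    change (φ.fE e).hom.hom x = (ψ.fE e).hom.hom x ↔
      (φ.fE e).hom.hom ((T.SE e).obj.ρ g x) = (ψ.fE e).hom.hom ((T.SE e).obj.ρ g x)
    rw [CovHom.fE_ρ, CovHom.fE_ρ]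
    constructor
    · intro h; rw [h]
    · intro h
      have h' := congrArg (fun z => (T'.SE e).obj.ρ g⁻¹ z) h
      change ((T'.SE e).obj.ρ g ≫ (T'.SE e).obj.ρ g⁻¹) _ =
        ((T'.SE e).obj.ρ g ≫ (T'.SE e).obj.ρ g⁻¹) _ at h'
      rw [← End.mul_def, ← map_mul, inv_mul_cancel, map_one] at h'
      exact h'
  | glue b v hb x =>
    change (φ.fE _).hom.hom x = (ψ.fE _).hom.hom x ↔
      (φ.fV v).hom.hom ((T.glue b v hb).hom.hom.hom x) = (ψ.fV v).hom.hom ((T.glue b v hb).hom.hom.hom x)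
    rw [← CovHom.glue_fE, ← CovHom.glue_fE]
    constructor
    · intro h; rw [h]
    · intro h
      have h' := congrArg (fun z => (T'.glue b v hb).inv.hom.hom z) h
      simp only [CovObj.glue_inv_hom] at h'
      exact h'

/-- Agreement is constant on components. [folklore] -/
private theorem agreePt_iff_of_sameComponent {p q : T.Point} (h : T.SameComponent p q) :
    AgreePt φ ψ p ↔ AgreePt φ ψ q := by
  induction h with
  | rel a b hab => exact agreePt_iff_of_adj φ ψ hab
  | refl a => exact Iff.rfl
  | symm a b _ ih => exact ih.symm
  | trans a b c _ _ ih1 ih2 => exact ih1.trans ih2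

/-- **Morphisms of coverings of a connected `𝒢` agreeing on the fibre over one vertex are equal.**
[cite: MochizukiSemiAnbd2006, Prop 3.6(ii) p.38] -/
theorem CovHom.ext_of_fV_eq (hc : 𝒢.graph.IsConnected) (v₀ : 𝒢.graph.Vertex)
    (h : φ.fV v₀ = ψ.fV v₀) : φ = ψ := by
  have hV : ∀ (v : 𝒢.graph.Vertex) (x : (T.SV v).obj.V), (φ.fV v).hom.hom x = (ψ.fV v).hom.hom x := by
    intro v x
    obtain ⟨x₁, hx₁⟩ := T.exists_mem_component_over hc x v₀
    have h1 : AgreePt φ ψ (Sum.inl ⟨v₀, x₁⟩) := by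
      change (φ.fV v₀).hom.hom x₁ = (ψ.fV v₀).hom.hom x₁
      rw [h]
    exact (agreePt_iff_of_sameComponent φ ψ hx₁).mpr h1
  refine CovHom.ext (funext fun v => ?_) (funext fun e => ?_)
  · apply ObjectProperty.hom_ext
    apply Action.Hom.ext
    apply ConcreteCategory.hom_ext
    intro x
    exact hV v x
  · apply ObjectProperty.hom_ext
    apply Action.Hom.ext
    apply ConcreteCategory.hom_ext
    intro y
    -- every edge abuts to a vertex; glue there and use injectivity of the gluing
    obtain ⟨b, hbe, hb⟩ := SemiGraph.exists_abuts_of_isConnected hc v₀ e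
    obtain ⟨v, hv⟩ := Option.isSome_iff_exists.mp hb
    subst hbe
    have h1 : AgreePt φ ψ (Sum.inl ⟨v, (T.glue b v hv).hom.hom.hom y⟩) := hV v _
    exact (agreePt_iff_of_adj φ ψ (CovObj.Adj.glue b v hv y)).mpr h1

end ProfiniteSemiGraph

end Literature.AnabelianGeometry.SemiGraphs
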